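import Literature.Probability.RandomPlanarGeometry.SAWPulledLargeForceExpansionZdHeights
import HarnessLib

/-!
# The pulled self-avoiding walk on `ℤ^{d+1}` at large force: EVERY coefficient `c_k^{(d)}` (`k ≥ 1`) IS EVEN, in every dimension

Topic `Literature/Probability/RandomPlanarGeometry` (continues `SAWPulledLargeForceExpansionZd.lean`: the cost census `costCoeffZd d c n = N_{c,n}(ℤ^{d+1})`
(irreducible bridges of `ℤ^{d+1}` of length `n` and cost `c = n − span`), the integer large-force coefficients `largeForceCoeffZd d k = c_k^{(d)}` of
`e^{λ_B(y)} = y Σ_k c_k^{(d)} y^{-k}`, and the cost-series engine `CostSeries.Pz / A / E / e`; uses `…ZdHeights.lean`'s height-profile tools).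

PRINTED CONTEXT (locators only). Janse van Rensburg–Whittington, J. Phys. A 46 (2013) 435003, §3.2 Theorem 8 (the expansion to first order);
Madras–Slade (1993) §1.2, §4.2. The planar values `c₁ … c₁₁ = 2, −2, 6, −20, 74, −284, 1100, −4188, 15148, −48674, 111428` (tree,
`largeForceCoeff_values`) and the lane's every-dimension polynomials through `c₁₁^{(d)}` are all even multiples of… — this file proves the
PARITY LAW behind that observation for EVERY order and EVERY dimension, structurally (no census value is used):

* §1 (generic, `namespace CostSeries`): ★ `C_dvd_one_sub_A` / ★★ `dvd_e_of_dvd_census` — if an integer `m` divides every census entry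
  `N_{c,n}` with `c ≥ 1`, then `m ∣ e_k` for every `k ≥ 1` (the recursion `A_{K+1} = 1 − Σ_c X^c P_c(A_K)` has `1 − A ≡ 0 (mod m)`, hence so has
  `E − 1 = Σ_{j ≥ 1} (1 − A)^j`);
* §2 the LATERAL REFLECTION `latNeg` (`(x₀, x₁, …, x_d) ↦ (x₀, −x₁, …, −x_d)`) preserves self-avoiding walks, bridges, renewal times, irreducibility
  and cost (`comp_latNeg_mem_irreducibleBridges_iff`, `costZd_comp_latNeg`), and FIXES an irreducible bridge only if it is the single vertical step
  (`costZd_eq_zero_of_latNeg_fixed`: a walk with no lateral displacement is vertical, a vertical self-avoiding bridge is monotone, a monotone irreducible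
  bridge has length one — `not_irreducible_of_monotone`);
* §3 ★★ `two_dvd_costCoeffZd`: `2 ∣ N_{c,n}(ℤ^{d+1})` for every `c ≥ 1`, `n`, `d` (a fixed-point-free involution on the census class);
  ★★★ `two_dvd_largeForceCoeffZd`: **`2 ∣ c_k^{(d)}` for every `k ≥ 1` and every `d`** — in particular every planar coefficient `c_k(ℤ²)`, `k ≥ 1`, is even.
[cite: JansevanRensburgWhittington2013, §3.2 Theorem 8 (arXiv v4 p. 11)] [cite: MadrasSlade1993, §4.2, eq. (4.2.20)–(4.2.22) (p. 94, 2013 reprint)]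
The definition `latNeg` is this file's tool notion (the reflection in the hyperplane spanned by the force axis); no number is taken from print.

Provenance: lane «pcv-sawmu», a-p3 g24 (2026-08-28).
-/

noncomputable section

open Finset
open scoped BigOperators
open Literature.Probability.LatticeModels
open Literature.Probability.RandomPlanarGeometry.SAW

namespace Literature.Probability.RandomPlanarGeometry.SAW.Zd

/-! ## §1 Divisibility passes from the census to every coefficient -/

namespace CostSeries

variable (N : ℕ → ℕ → ℕ)

/-- If `m` divides every entry of the cost-`c` column then `C m ∣ P_c(q)` for every polynomial `q`. [cite: JansevanRensburgWhittington2013, §3.2 Theorem 8 (arXiv v4 p. 11)] -/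
theorem C_dvd_Pz_comp (m : ℤ) {c : ℕ} (h : ∀ n, m ∣ (N c n : ℤ)) (q : Polynomial ℤ) :
    Polynomial.C m ∣ (Pz N c).comp q := by
  rw [Pz, Polynomial.sum_comp]
  refine Finset.dvd_sum fun n _ => ?_
  rw [Polynomial.mul_comp, Polynomial.C_comp, Polynomial.X_pow_comp]
  obtain ⟨t, ht⟩ := h n
  exact Dvd.intro (Polynomial.C t * q ^ n) (by rw [← mul_assoc, ← Polynomial.C_mul, ← ht])

/-- ★ If `m` divides every census entry `N_{c,n}` with `c ≥ 1`, then `1 − A_K ≡ 0 (mod m)` coefficientwise, for every `K`.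
[cite: JansevanRensburgWhittington2013, §3.2 Theorem 8 (arXiv v4 p. 11)] -/
theorem C_dvd_one_sub_A (m : ℤ) (h : ∀ c, 1 ≤ c → ∀ n, m ∣ (N c n : ℤ)) : ∀ K, Polynomial.C m ∣ 1 - A N K
  | 0 => by simp [A]
  | K + 1 => by
    have hA : A N (K + 1) = 1 - ∑ j ∈ Finset.range (K + 1), Polynomial.X ^ (j + 1) * (Pz N (j + 1)).comp (A N K) := rfl
    rw [hA, sub_sub_cancel]
    exact Finset.dvd_sum fun j _ => dvd_mul_of_dvd_right (C_dvd_Pz_comp N m (h (j + 1) (by omega)) _) _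

/-- ★★ **DIVISIBILITY TRANSFER**: if `m` divides every census entry `N_{c,n}` with `c ≥ 1`, then `m ∣ e_k` for every `k ≥ 1`
(`E_k − 1 = Σ_{1 ≤ j ≤ k} (1 − A_k)^j`). [cite: JansevanRensburgWhittington2013, §3.2 Theorem 8 (arXiv v4 p. 11)] -/
theorem dvd_e_of_dvd_census (m : ℤ) (h : ∀ c, 1 ≤ c → ∀ n, m ∣ (N c n : ℤ)) {k : ℕ} (hk : 1 ≤ k) : m ∣ e N k := by
  have hE : e N k = ∑ j ∈ Finset.range (k + 1), ((1 - A N k) ^ j).coeff k := by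
    rw [e, E, Polynomial.finsetSum_coeff]
  rw [hE]
  refine Finset.dvd_sum fun j _ => ?_
  rcases Nat.eq_zero_or_pos j with rfl | hj
  · rw [pow_zero, Polynomial.coeff_one, if_neg (by omega)]
    exact dvd_zero m
  · have hd : Polynomial.C m ∣ (1 - A N k) ^ j := dvd_pow (C_dvd_one_sub_A N m h k) (by omega)
    exact (Polynomial.C_dvd_iff_dvd_coeff m _).1 hd k

end CostSeries

/-! ## §2 The lateral reflection -/

/-- The lateral reflection of `ℤ^{d+1}`: keep the force coordinate `x₀`, negate every other coordinate. [cite: MadrasSlade1993, §4.2, eq. (4.2.20)–(4.2.22) (p. 94, 2013 reprint)] -/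
def latNeg (d : ℕ) (x : Site (d + 1)) : Site (d + 1) := fun a => if a = 0 then x a else -x a

/-- The force coordinate is unchanged. [cite: MadrasSlade1993, §4.2, eq. (4.2.20)–(4.2.22) (p. 94, 2013 reprint)] -/
@[simp] theorem latNeg_apply_zero (d : ℕ) (x : Site (d + 1)) : latNeg d x 0 = x 0 := by simp [latNeg]

/-- A lateral coordinate is negated. [cite: MadrasSlade1993, §4.2, eq. (4.2.20)–(4.2.22) (p. 94, 2013 reprint)] -/
theorem latNeg_apply_of_ne (d : ℕ) (x : Site (d + 1)) {a : Fin (d + 1)} (ha : a ≠ 0) : latNeg d x a = -x a := by simp [latNeg, ha]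

/-- The reflection is an involution. [cite: MadrasSlade1993, §4.2, eq. (4.2.20)–(4.2.22) (p. 94, 2013 reprint)] -/
@[simp] theorem latNeg_latNeg (d : ℕ) (x : Site (d + 1)) : latNeg d (latNeg d x) = x := by
  funext a; by_cases ha : a = 0 <;> simp [latNeg, ha]

/-- The reflection fixes the origin. [cite: MadrasSlade1993, §4.2, eq. (4.2.20)–(4.2.22) (p. 94, 2013 reprint)] -/
@[simp] theorem latNeg_zero (d : ℕ) : latNeg d (0 : Site (d + 1)) = 0 := by
  funext a; by_cases ha : a = 0 <;> simp [latNeg, ha]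

/-- The reflection is additive. [cite: MadrasSlade1993, §4.2, eq. (4.2.20)–(4.2.22) (p. 94, 2013 reprint)] -/
theorem latNeg_add (d : ℕ) (x y : Site (d + 1)) : latNeg d (x + y) = latNeg d x + latNeg d y := by
  funext a; by_cases ha : a = 0 <;> simp [latNeg, ha, add_comm]

/-- The reflection is injective. [cite: MadrasSlade1993, §4.2, eq. (4.2.20)–(4.2.22) (p. 94, 2013 reprint)] -/
theorem latNeg_injective (d : ℕ) : Function.Injective (latNeg d) := fun x y h => by
  simpa using congrArg (latNeg d) h

/-- The reflection of a unit vector is `±` the same unit vector. [cite: MadrasSlade1993, §4.2, eq. (4.2.20)–(4.2.22) (p. 94, 2013 reprint)] -/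
theorem latNeg_single (d : ℕ) (i : Fin (d + 1)) :
    latNeg d (Pi.single i 1) = Pi.single i 1 ∨ latNeg d (Pi.single i 1) = -Pi.single i 1 := by
  by_cases hi : i = 0
  · left; funext a; by_cases ha : a = 0
    · simp [latNeg, ha]
    · have : a ≠ i := fun h => ha (h ▸ hi)
      simp [latNeg, ha, this]
  · right; funext a; by_cases ha : a = 0
    · subst ha
      have h0i : (0 : Fin (d + 1)) ≠ i := fun h => hi h.symm
      simp [latNeg, h0i]
    · simp [latNeg, ha]

/-- The reflection preserves adjacency in `ℤ^{d+1}`. [cite: MadrasSlade1993, §4.2, eq. (4.2.20)–(4.2.22) (p. 94, 2013 reprint)] -/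
theorem zdGraph_adj_latNeg (d : ℕ) {x y : Site (d + 1)} (h : (zdGraph (d + 1)).Adj x y) :
    (zdGraph (d + 1)).Adj (latNeg d x) (latNeg d y) := by
  rw [zdGraph_adj_iff] at h ⊢
  obtain ⟨i, hi | hi⟩ := h
  · rcases latNeg_single d i with hs | hs
    · exact ⟨i, Or.inl (by rw [hi, latNeg_add, hs])⟩
    · refine ⟨i, Or.inr ?_⟩
      rw [hi, latNeg_add, hs]; abel
  · rcases latNeg_single d i with hs | hs
    · exact ⟨i, Or.inr (by rw [hi, latNeg_add, hs])⟩
    · refine ⟨i, Or.inl ?_⟩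
      rw [hi, latNeg_add, hs]; abel

/-- The reflection preserves adjacency (iff form). [cite: MadrasSlade1993, §4.2, eq. (4.2.20)–(4.2.22) (p. 94, 2013 reprint)] -/
theorem zdGraph_adj_latNeg_iff (d : ℕ) (x y : Site (d + 1)) :
    (zdGraph (d + 1)).Adj (latNeg d x) (latNeg d y) ↔ (zdGraph (d + 1)).Adj x y :=
  ⟨fun h => by simpa using zdGraph_adj_latNeg d h, zdGraph_adj_latNeg d⟩

/-- The reflected walk. [cite: MadrasSlade1993, §4.2, eq. (4.2.20)–(4.2.22) (p. 94, 2013 reprint)] -/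
theorem comp_latNeg_mem_saws_iff (d : ℕ) {n : ℕ} (ω : ℕ → Site (d + 1)) :
    (fun i => latNeg d (ω i)) ∈ saws (d + 1) n ↔ ω ∈ saws (d + 1) n := by
  constructor
  · intro h
    obtain ⟨h0, hc, hadj, hinj⟩ := mem_saws.1 h
    refine mem_saws.2 ⟨?_, fun i hi => ?_, fun i hi => ?_, fun i hi j hj hij => ?_⟩
    · exact latNeg_injective d (by simpa using h0)
    · exact latNeg_injective d (hc i hi)
    · exact (zdGraph_adj_latNeg_iff d _ _).1 (hadj i hi)
    · exact hinj hi hj (by simp only [hij])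
  · intro h
    obtain ⟨h0, hc, hadj, hinj⟩ := mem_saws.1 h
    refine mem_saws.2 ⟨by simp [h0], fun i hi => by simp only [hc i hi], fun i hi => zdGraph_adj_latNeg d (hadj i hi),
      fun i hi j hj hij => hinj hi hj (latNeg_injective d hij)⟩

/-- Bridges are decided by the force coordinate. [cite: MadrasSlade1993, Definition 3.1.2] -/
theorem isBridge_congr_zero {d n : ℕ} {ω ω' : ℕ → Site (d + 1)} (h : ∀ i, ω i 0 = ω' i 0) : IsBridge n ω ↔ IsBridge n ω' := by
  unfold IsBridge; simp only [h]

/-- Renewal times are decided by the force coordinate. [cite: DuminilCopinHammond2013, §2.2] -/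
theorem isRenewalTime_congr_zero {d n : ℕ} {ω ω' : ℕ → Site (d + 1)} (h : ∀ i, ω i 0 = ω' i 0) (i : ℕ) :
    IsRenewalTime n ω i ↔ IsRenewalTime n ω' i := by
  unfold IsRenewalTime
  rw [isBridge_congr_zero h, isBridge_congr_zero (ω := fun k => ω (i + k)) (ω' := fun k => ω' (i + k)) (fun k => h (i + k))]

/-- Irreducibility is decided by the force coordinate. [cite: DuminilCopinHammond2013, §2.2] -/
theorem isIrreducibleBridge_congr_zero {d n : ℕ} {ω ω' : ℕ → Site (d + 1)} (h : ∀ i, ω i 0 = ω' i 0) :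
    IsIrreducibleBridge n ω ↔ IsIrreducibleBridge n ω' := by
  unfold IsIrreducibleBridge
  rw [isBridge_congr_zero h]
  simp only [isRenewalTime_congr_zero h]

/-- ★ The reflected walk is an irreducible bridge iff the walk is. [cite: DuminilCopinHammond2013, §2.2] -/
theorem comp_latNeg_mem_irreducibleBridges_iff (d : ℕ) {n : ℕ} (ω : ℕ → Site (d + 1)) :
    (fun i => latNeg d (ω i)) ∈ irreducibleBridges (d + 1) n ↔ ω ∈ irreducibleBridges (d + 1) n := by
  have h0 : ∀ i, (fun i => latNeg d (ω i)) i 0 = ω i 0 := fun i => latNeg_apply_zero d (ω i)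
  rw [mem_irreducibleBridges, mem_irreducibleBridges, mem_bridges, mem_bridges, comp_latNeg_mem_saws_iff,
    isBridge_congr_zero h0, isIrreducibleBridge_congr_zero h0]

/-- The cost is unchanged by the reflection. [cite: MadrasSlade1993, §4.2, eq. (4.2.20)–(4.2.22) (p. 94, 2013 reprint)] -/
@[simp] theorem costZd_comp_latNeg (d n : ℕ) (ω : ℕ → Site (d + 1)) : costZd d n (fun i => latNeg d (ω i)) = costZd d n ω := by
  simp [costZd]

/-- ★ A FIXED walk of the reflection is vertical, hence (as an irreducible bridge) the single up-step: its cost is `0`.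
[cite: DuminilCopinHammond2013, §2.2] -/
theorem costZd_eq_zero_of_latNeg_fixed (d : ℕ) {n : ℕ} {ω : ℕ → Site (d + 1)} (hω : ω ∈ irreducibleBridges (d + 1) n)
    (hfix : (fun i => latNeg d (ω i)) = ω) : costZd d n ω = 0 := by
  classical
  obtain ⟨hbr, hI⟩ := mem_irreducibleBridges.1 hω
  obtain ⟨hωs, hb⟩ := mem_bridges.1 hbr
  obtain ⟨h0, -, hadj, -⟩ := mem_saws.1 hωs
  have hn1 : 1 ≤ n := hI.1
  -- every lateral coordinate vanishes
  have hlat : ∀ i (a : Fin (d + 1)), a ≠ 0 → ω i a = 0 := by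
    intro i a ha
    have h := congrFun (congrFun hfix i) a
    rw [latNeg_apply_of_ne d (ω i) ha] at h
    omega
  -- so every step is `± e₀`
  have hstep : ∀ i < n, ω (i + 1) 0 = ω i 0 + 1 ∨ ω (i + 1) 0 = ω i 0 - 1 := by
    intro i hi
    obtain ⟨j, hj | hj⟩ := (zdGraph_adj_iff _ _).1 (hadj i hi)
    · by_cases hj0 : j = 0
      · subst hj0; left; rw [hj]; simp
      · have := congrFun hj j
        rw [hlat (i + 1) j hj0, Pi.add_apply, hlat i j hj0, Pi.single_eq_same] at this
        omega
    · by_cases hj0 : j = 0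
      · subst hj0; right; have := congrFun hj 0; simp at this; omega
      · have := congrFun hj j
        rw [hlat i j hj0, Pi.add_apply, hlat (i + 1) j hj0, Pi.single_eq_same] at this
        omega
  -- a vertical self-avoiding bridge is monotone: the first step is up, and up is never followed by down
  have hup : ∀ i < n, ω (i + 1) 0 = ω i 0 + 1 := by
    intro i
    induction i with
    | zero =>
      intro _
      rw [apply_one_eq_e0_of_mem_bridges d hn1 hbr, h0]; simp
    | succ i ih =>
      intro hi
      rcases hstep (i + 1) hi with h | h
      · exact h
      · exact (no_up_down_of_mem_saws d hωs (by omega) (ih (by omega)) h).elim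
  have hmono : ∀ i < n, ω i 0 ≤ ω (i + 1) 0 := fun i hi => by rw [hup i hi]; omega
  have hh : ∀ i ≤ n, ω i 0 = i := by
    intro i
    induction i with
    | zero => intro _; rw [h0]; rfl
    | succ i ih => intro hi; rw [hup i (by omega), ih (by omega)]; push_cast; ring
  -- length `≥ 2` would make height `n ≥ 2`, contradicting irreducibility
  have hn : n = 1 := by
    by_contra hne
    exact not_irreducible_of_monotone d hω hmono (by rw [hh n le_rfl]; omega)
  subst hn
  rw [costZd, hh 1 le_rfl]; rfl

/-! ## §3 Parity -/

/-- ★★ **EVERY COST CELL WITH `c ≥ 1` IS EVEN**: `2 ∣ N_{c,n}(ℤ^{d+1})` (the lateral reflection is a fixed-point-free involution of the class).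
[cite: MadrasSlade1993, §4.2, eq. (4.2.20)–(4.2.22) (p. 94, 2013 reprint)] -/
theorem two_dvd_costCoeffZd (d : ℕ) {c : ℕ} (hc : 1 ≤ c) (n : ℕ) : 2 ∣ costCoeffZd d c n := by
  classical
  set S := (irreducibleBridges (d + 1) n).filter fun ω => costZd d n ω = c with hS
  have hmem : ∀ ω ∈ S, (fun i => latNeg d (ω i)) ∈ S := by
    intro ω hω
    obtain ⟨h1, h2⟩ := Finset.mem_filter.1 hω
    exact Finset.mem_filter.2 ⟨(comp_latNeg_mem_irreducibleBridges_iff d ω).2 h1, by rw [costZd_comp_latNeg, h2]⟩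
  have hne : ∀ ω ∈ S, (fun i => latNeg d (ω i)) ≠ ω := by
    intro ω hω hfix
    obtain ⟨h1, h2⟩ := Finset.mem_filter.1 hω
    have := costZd_eq_zero_of_latNeg_fixed d h1 hfix
    omega
  have hsum : ∑ ω ∈ S, (1 : ZMod 2) = 0 :=
    Finset.sum_involution (fun ω _ => fun i => latNeg d (ω i)) (fun ω _ => by decide) (fun ω hω _ => hne ω hω)
      (fun ω hω => hmem ω hω) (fun ω _ => by funext i; simp)
  have hcard : ((S.card : ℕ) : ZMod 2) = 0 := by
    rw [Finset.card_eq_sum_ones, Nat.cast_sum]; simpa using hsum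
  rw [costCoeffZd, ← hS]
  exact (ZMod.natCast_eq_zero_iff S.card 2).1 hcard

/-- ★★★ **THE PARITY LAW: `2 ∣ c_k^{(d)}` for every `k ≥ 1` and every dimension `d`** — every coefficient of the large-force expansion
`e^{λ_B(y)} = y + Σ_{k ≥ 1} c_k^{(d)} y^{1−k}` of the pulled self-avoiding walk on `ℤ^{d+1}` is an even integer.
[cite: JansevanRensburgWhittington2013, §3.2 Theorem 8 (arXiv v4 p. 11)] -/
theorem two_dvd_largeForceCoeffZd (d : ℕ) {k : ℕ} (hk : 1 ≤ k) : (2 : ℤ) ∣ largeForceCoeffZd d k :=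
  CostSeries.dvd_e_of_dvd_census (costCoeffZd d) 2 (fun c hc n => by exact_mod_cast two_dvd_costCoeffZd d hc n) hk

/-- In particular every planar coefficient `c_k(ℤ²)`, `k ≥ 1`, is even. [cite: JansevanRensburgWhittington2013, §3.2 Theorem 8 (arXiv v4 p. 11)] -/
theorem two_dvd_largeForceCoeff {k : ℕ} (hk : 1 ≤ k) : (2 : ℤ) ∣ largeForceCoeff k := by
  rw [← largeForceCoeffZd_one]; exact two_dvd_largeForceCoeffZd 1 hk

end Literature.Probability.RandomPlanarGeometry.SAW.Zd

end
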